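import Summits.Ventures.CertifiedArithmetic.LowPrec.SRPythagorasNoise
import HarnessLib

/-!
# SR accumulation with few random bits, CXI: the variance side of the noise functional

HONEST FRAMING: certified error envelopes and provably optimal rounding/accumulation schemes for
low-precision formats under stated cost models; every table by two implementations; no hardware or
vendor claims.

File CX split the mean squared error of a limited-randomness SR accumulation (rule `q`, outcome
tree of `s + x₀ + ⋯ + xₙ₋₁`) as `E(ŝₙ − sₙ)² = 𝒩 + ℬ` and derived the Pythagorean law
`E(ŝₙ − sₙ)² ≤ n·G²/4 + (n·ε·G)²` from the GLOBAL criterion `𝒩 ≤ n·G²/4` and from the decidable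
LOCAL budget `NoiseBudget G`.  This file puts the VARIANCE of the computed sum next to `𝒩`.

1. THE VARIANCE FUNCTIONAL (`varQ`, all rules, all trees, no hypotheses).  With
   `D(c) = E[ŝₙ | up c] − E[ŝₙ | dn c]` the MEAN GAP of a branch point (`meanGap`: expected final
   sum from the upper candidate minus that from the lower one) and `π = pUpQ c`,
   `Var ŝₙ = E Σₖ πₖ(1−πₖ)·Dₖ²` (`accExpQ_var_eq_varQ`: the variance of the Doob martingale
   `E[ŝₙ | ŝₖ]`, i.e. the law of total variance along the tree) and
   `E(ŝₙ − e)² = Var ŝₙ + (E ŝₙ − e)²` for every centre `e` (`accExpQ_sq_eq_varQ_add_sq`).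
2. NOISE VERSUS VARIANCE.  The sibling drift gap of CX is `Δ = D − w` (`w = up c − dn c`;
   `driftGap_eq_meanGap_sub`), the node noise is `π(1−π)·w·(2D − w)`, and
   `π(1−π)·D² − nodeNoise = π(1−π)·Δ²` exactly (`nodeVar_sub_nodeNoise`); hence `𝒩 ≤ Var ŝₙ`
   for every rule with `q[0,1] ⊆ [0,1]` (`noiseQ_le_varQ`; the deficit `E Σ π(1−π)Δ²` is the
   variance of the accumulated conditional bias `R`).  So the GLOBAL VARIANCE CRITERION
   `Var ŝₙ ≤ B ⇒ E(ŝₙ − sₙ)² ≤ B + (n·ε·G)²` (`accExpQ_sq_le_of_varQ_le`) is a special case of CX's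
   noise criterion, and the conjecture `NOISE-LE` of CX follows from
   `VAR-LE : Var ŝₙ ≤ n·G²/4` ("limited randomness never pushes the variance of the computed sum
   above the exact-SR worst case").
3. THE MEAN-GAP CRITERION (local, decidable: `MeanGapLE G`, `instDecidableMeanGapLE`): if at every
   branch point the expected final sums from the two candidates differ by at most one top spacing,
   `D ≤ G`, then `NoiseBudget G` holds (`noiseBudget_of_meanGapLE`: `w·(2D − w) ≤ w·(2G − w) ≤ G²`),
   hence the law (`accExpQ_sq_le_of_meanGapLE`); and `GapLE G ∧ DriftAntitone ⇒ MeanGapLE G`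
   (`meanGapLE_of_driftAntitone`: `D = w + Δ ≤ w ≤ G`).  The chain
   `DriftAntitone ⊊ MeanGapLE ⊊ NoiseBudget ⊊ (𝒩 ≤ n·G²/4)` is STRICT for `StochasticA` with two
   random bits on one-signed nested windows (kernel, namespace `Formats`): the six sharpness
   witnesses of the bits threshold satisfy `MeanGapLE` but are not drift-antitone
   (`threshold_witnesses_meanGapLE`, CI); from `5/4` add `45/16, −31/8, 11/2` (window `[1/8, 7]`,
   `G = 1`) satisfies `NoiseBudget 1` but has a mean gap `9/8 > G`
   (`e3m2_noiseBudget_not_meanGapLE`); CX's tree `xNB` violates `NoiseBudget 2` but has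
   `Var ŝ₃ = 423/256 ≤ 3·G²/4`, so its law also follows from the variance criterion
   (`e3m2_xNB_varLE`); equality `Var ŝ₃ = 3·G²/4` at three fair coins (`e3m2_varQ_attains`).
4. `StochasticA` specialisations (`ε = 2^{-N}`): `stochasticA_acc_sq_le_of_meanGapLE`,
   `stochasticA_acc_sq_le_of_varQ_le`.

NOT proved here, recorded with their evidence.  CONJECTURE `VAR-LE`: `Var ŝₙ ≤ n·G²/4` for
`StochasticA`, `N ≥ 1`, on every outcome tree inside a one-signed nested window with top spacing
`G`.  Certificate `gen20/var` (two independent implementations, byte-identical tables; the 46 540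
trees of certificate `gen20/noise` = 41 297 random-family trees of `gen19/jump` + 5 243 adversarial
`zigzag` trees, `N = 1, 2, 3`, E3M2 and E2M1): the identity of item 1 and `𝒩 ≤ Var` on every tree;
`DriftAntitone ⇒ MeanGapLE ⇒ NoiseBudget` with `0` exceptions, `3 893` trees in the first gap,
`123` in the second; `MeanGapLE` on all `26 130` random-family trees with `N ≥ 2` and violated by
`205` trees overall (zigzag, `N = 1, 2, 3`); `VAR-LE`: ZERO violations, also with `G` replaced by
the largest cell met, maximum ratio `1` (equally spaced windows); the mean gap is `≥ 0` at every
node of every tree (stochastic monotonicity of the `StochasticA` step: CXII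
`SRPythagorasMeanMonotone`).  STATUS (2026-08-21, certificate `gen20/ratchet`, two
implementations, exact arithmetic): `VAR-LE` IS FALSE IN GENERAL.  On the positive values of a
binary format with FIVE mantissa bits (32 cells per binade; spacings `1, 2, 4` on `[32,64)`,
`[64,128)`, `[128,256)`), `N = 1`, the RATCHET family `s = 128`, `x₀ = 5/2`, then `m` cycles
`(−67, +137/2)` stays in the nested window `[61, 252]` (`G = 4`, no saturation) and has root
mean gap `D = G(1 + m/4)` (exactly for `m ≤ 16`, up to dyadic dust `< 10⁻⁵·G` beyond, when the
top of the cloud no longer drops below `128`): the lower sibling `128` is sent to the grid point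
`61` and back to
`259/2 ↦ 128` deterministically (bias `−3/2` per cycle), the upper sibling to the midpoint
`65 + 4k` of a spacing-`2` cell (unbiased split, re-misaligning the pair) and back with bias
`−1/2`; the root alone contributes `(G²/4)(1 + m/4)²` and `Var ŝₙ/(n·G²/4) = 1.0304` at
`n = 39` (`m = 19`), `1.1529` at `n = 47`.  E3M2/E2M1 (≤ 4 cells per binade) run out of fresh
top cells after three cycles, whence the `0` violations above.  The regime `2 ≤ N < J` is NOT
exempt (certificate `gen20/ratchet2`): the same ratchet `N` binades down — lower sibling pinned
`N+1` binades below the top, upper split at a midpoint `N` binades below, gain `G/2^(N+1)` per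
cycle — gives, for `N = 2` on SEVEN mantissa bits (`s = 512`, `x₀ = 2`, cycles `(−775/2, +388)`,
window `[249/2, 516 + 4m]`, `G = 4`), `D = G(1 + m/8)` exactly for `m ≤ 96` and
`Var ŝₙ/(n·G²/4) = 1.0078` at `n = 199` (`m = 99`; `N = 3`: `n = 903` on nine bits, checked with
one implementation only).  `NOISE-LE` (ratio `≤ 1` on both families, `≈ 0.45` resp. `0.24`
along them) and the law (ratio `≤ 0.54`) are NOT refuted and remain open; the implication
`VAR-LE ⇒ NOISE-LE` is moot.  Two natural SHARPENINGS of `NOISE-LE` are FALSE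
and must not be used as induction hypotheses: the per-step increment bound
`𝒩(first m+1 steps) − 𝒩(first m steps) ≤ G²/4` (violated by `46` zigzag trees, ratio up to
`21/16`; kernel: `e3m2_noise_increment_exceeds`, `N = 2`) and the pathwise bound
`Σₖ nodeNoise(cₖ) ≤ n·G²/4` along every root-to-leaf path (no violation in the census, but ratio
`33/32` on a hill-climbing tree with `N = 1`, `n = 6`, where the law itself is a theorem, CIII;
certificate kernel row `extra_e3m2_oneBit_pathwise_exceeds`).

References.  The one-step variance `ε²·q_r(1−q_r) ≤ u²/4` of limited-precision SR, independent of
the number of random bits, is [ElararEtAl2025, §3, before Lem 3.3]; their summation analysis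
(Thm 3.5–3.6 with [ArarEtAl2023]) is first order in `u` and treats the bias separately; the
unbiased case `D ≡ w` is [ConnollyHighamMary2021, Lem 6.3/Thm 6.4]; [FitzgibbonFelix2025] studies
the bias of few-bit SR, not its variance.  No source states the exact tree identity
`Var ŝₙ = E Σ π(1−π)·D²` with the propagated mean gap `D`, the mean-gap criterion, or the strict
hierarchy of item 3 (searches, both corpora: unit FRESHNESS-SR.md, QUESTION U).
-/

namespace Summit.Ventures.CertifiedArithmetic.LowPrec.SR

open Literature.ComputerArithmetic.ConnollyHighamMary2021
open Finset

variable {K : Type*} [Field K] [LinearOrder K] [IsStrictOrderedRing K]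

namespace LimitedBits

/-- MEAN GAP `D(c)` of the branch point `c` (remaining summands `x`, `n` more steps): expected
final sum from the upper candidate minus expected final sum from the lower candidate. -/
def meanGap (F : Finset K) (q : K → K) (x : ℕ → K) (n : ℕ) (c : K) : K :=
  accExpQ F q x n (fun y => y) (up F c) - accExpQ F q x n (fun y => y) (dn F c)

/-- NODE VARIANCE `π(1−π)·D²`: the conditional variance of the martingale `E[ŝₙ | ŝₖ]` at the
branch point. -/
def nodeVar (F : Finset K) (q : K → K) (x : ℕ → K) (n : ℕ) (c : K) : K :=
  pUpQ F q c * (1 - pUpQ F q c) * meanGap F q x n c ^ 2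

/-- The VARIANCE FUNCTIONAL `E Σₖ πₖ(1−πₖ)·Dₖ²` of the outcome tree, as a backward recursion. -/
def varQ (F : Finset K) (q : K → K) : (ℕ → K) → ℕ → K → K
  | _, 0, _ => 0
  | x, n + 1, s => nodeVar F q (fun i => x (i + 1)) n (s + x 0)
      + stepQ F q (s + x 0) (varQ F q (fun i => x (i + 1)) n)

omit [IsStrictOrderedRing K] in
/-- `Δ = D − w`: CX's sibling drift gap is the mean gap minus the cell width. -/
theorem driftGap_eq_meanGap_sub (F : Finset K) (q : K → K) (x : ℕ → K) (n : ℕ) (c : K) :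
    driftGap F q x n c = meanGap F q x n c - (up F c - dn F c) := by
  unfold driftGap meanGap; ring

omit [IsStrictOrderedRing K] in
/-- `nodeNoise = π(1−π)·w·(2D − w)` in terms of the mean gap. -/
theorem nodeNoise_eq (F : Finset K) (q : K → K) (x : ℕ → K) (n : ℕ) (c : K) :
    nodeNoise F q x n c = pUpQ F q c * (1 - pUpQ F q c) * (up F c - dn F c)
      * (2 * meanGap F q x n c - (up F c - dn F c)) := by
  unfold nodeNoise; rw [driftGap_eq_meanGap_sub]; ring

omit [IsStrictOrderedRing K] in
/-- **`nodeVar − nodeNoise = π(1−π)·Δ²`** exactly. -/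
theorem nodeVar_sub_nodeNoise (F : Finset K) (q : K → K) (x : ℕ → K) (n : ℕ) (c : K) :
    nodeVar F q x n c - nodeNoise F q x n c
      = pUpQ F q c * (1 - pUpQ F q c) * driftGap F q x n c ^ 2 := by
  rw [nodeNoise_eq, driftGap_eq_meanGap_sub]; unfold nodeVar; ring

omit [IsStrictOrderedRing K] in
/-- **`Var ŝₙ = E Σₖ πₖ(1−πₖ)·Dₖ²`** (law of total variance along the outcome tree; every rule `q`,
every value set, no hypotheses). -/
theorem accExpQ_var_eq_varQ (F : Finset K) (q : K → K) :
    ∀ (x : ℕ → K) (n : ℕ) (s : K),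
      accExpQ F q x n (fun y => y ^ 2) s - accExpQ F q x n (fun y => y) s ^ 2 = varQ F q x n s := by
  intro x n
  induction n generalizing x with
  | zero => intro s; simp [accExpQ, varQ]
  | succ n ih =>
    intro s
    simp only [varQ, nodeVar, meanGap]
    show stepQ F q (s + x 0) (accExpQ F q (fun i => x (i + 1)) n (fun y => y ^ 2))
        - stepQ F q (s + x 0) (accExpQ F q (fun i => x (i + 1)) n (fun y => y)) ^ 2 = _
    simp only [stepQ]
    rw [← ih (fun i => x (i + 1)) (up F (s + x 0)), ← ih (fun i => x (i + 1)) (dn F (s + x 0))]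
    ring

omit [IsStrictOrderedRing K] in
/-- **`E(ŝₙ − e)² = Var ŝₙ + (E ŝₙ − e)²`** for every centre `e`. -/
theorem accExpQ_sq_eq_varQ_add_sq (F : Finset K) (q : K → K) (x : ℕ → K) (n : ℕ) (s e : K) :
    accExpQ F q x n (fun y => (y - e) ^ 2) s
      = varQ F q x n s + (accExpQ F q x n (fun y => y) s - e) ^ 2 := by
  have h1 : (fun y : K => (y - e) ^ 2)
      = fun y => 1 * y ^ 2 + 1 * ((-2 * e) * y + e ^ 2 * 1) := by
    funext y; ring
  rw [h1, accExpQ_lin, accExpQ_lin, accExpQ_one, ← accExpQ_var_eq_varQ]; ring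

/-- **`𝒩 ≤ Var ŝₙ`** whenever `q` maps `[0,1]` into `[0,1]`. -/
theorem noiseQ_le_varQ (F : Finset K) {q : K → K}
    (hq01 : ∀ η, 0 ≤ η → η ≤ 1 → 0 ≤ q η ∧ q η ≤ 1) :
    ∀ (x : ℕ → K) (n : ℕ) (s : K), noiseQ F q x n s ≤ varQ F q x n s := by
  intro x n
  induction n generalizing x with
  | zero => intro s; simp [noiseQ, varQ]
  | succ n ih =>
    intro s
    simp only [noiseQ, varQ, stepQ]
    obtain ⟨hp0, hp1⟩ := pUpQ_mem F hq01 (s + x 0)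
    have h0 : nodeNoise F q (fun i => x (i + 1)) n (s + x 0)
        ≤ nodeVar F q (fun i => x (i + 1)) n (s + x 0) := by
      have := nodeVar_sub_nodeNoise F q (fun i => x (i + 1)) n (s + x 0)
      nlinarith [mul_nonneg (mul_nonneg hp0 (sub_nonneg.mpr hp1))
        (sq_nonneg (driftGap F q (fun i => x (i + 1)) n (s + x 0)))]
    have a1 := mul_le_mul_of_nonneg_left (ih (fun i => x (i + 1)) (up F (s + x 0))) hp0
    have a2 := mul_le_mul_of_nonneg_left (ih (fun i => x (i + 1)) (dn F (s + x 0)))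
      (sub_nonneg.mpr hp1)
    linarith

/-- **The Pythagorean law from a variance bound** (GLOBAL VARIANCE CRITERION):
`NoSat ∧ GapLE G ∧ Var ŝₙ ≤ B ⇒ E(ŝₙ − sₙ)² ≤ B + (n·ε·G)²`. -/
theorem accExpQ_sq_le_of_varQ_le (F : Finset K) {q : K → K} {ε G B : K}
    (hq01 : ∀ η, 0 ≤ η → η ≤ 1 → 0 ≤ q η ∧ q η ≤ 1) (hq : ∀ η, 0 ≤ η → η ≤ 1 → |q η - η| ≤ ε)
    (x : ℕ → K) (n : ℕ) (s : K) (hns : NoSat F x n s) (hgap : GapLE F G x n s)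
    (hV : varQ F q x n s ≤ B) :
    accExpQ F q x n (fun t => (t - (s + ∑ i ∈ range n, x i)) ^ 2) s ≤ B + (n * (ε * G)) ^ 2 :=
  accExpQ_sq_le_of_noiseQ_le F hq01 hq x n s hns hgap ((noiseQ_le_varQ F hq01 x n s).trans hV)

/-! ### The mean-gap criterion -/

/-- `MeanGapLE F q G x n s`: at every branch point of the outcome tree the mean gap is at most
`G`: `E[ŝₙ | up c] − E[ŝₙ | dn c] ≤ G`. -/
def MeanGapLE (F : Finset K) (q : K → K) (G : K) : (ℕ → K) → ℕ → K → Prop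
  | _, 0, _ => True
  | x, n + 1, s => meanGap F q (fun i => x (i + 1)) n (s + x 0) ≤ G
      ∧ MeanGapLE F q G (fun i => x (i + 1)) n (up F (s + x 0))
      ∧ MeanGapLE F q G (fun i => x (i + 1)) n (dn F (s + x 0))

/-- Boolean evaluator of `MeanGapLE` (clean kernel reduction for `decide` certificates). -/
def meanGapLEB (F : Finset K) (q : K → K) (G : K) : (ℕ → K) → ℕ → K → Bool
  | _, 0, _ => true
  | x, n + 1, s => decide (meanGap F q (fun i => x (i + 1)) n (s + x 0) ≤ G)
      && meanGapLEB F q G (fun i => x (i + 1)) n (up F (s + x 0))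
      && meanGapLEB F q G (fun i => x (i + 1)) n (dn F (s + x 0))

omit [IsStrictOrderedRing K] in
/-- `meanGapLEB` computes `MeanGapLE`. -/
theorem meanGapLEB_iff (F : Finset K) (q : K → K) (G : K) (x : ℕ → K) (n : ℕ) (s : K) :
    meanGapLEB F q G x n s = true ↔ MeanGapLE F q G x n s := by
  induction n generalizing x s with
  | zero => simp [meanGapLEB, MeanGapLE]
  | succ n ih => simp [meanGapLEB, MeanGapLE, ih, Bool.and_eq_true, and_assoc]

/-- `MeanGapLE` is decidable (via `meanGapLEB`). -/
instance instDecidableMeanGapLE (F : Finset K) (q : K → K) (G : K) (x : ℕ → K) (n : ℕ) (s : K) :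
    Decidable (MeanGapLE F q G x n s) :=
  decidable_of_iff _ (meanGapLEB_iff F q G x n s)

/-- **`MeanGapLE G ⇒ NoiseBudget G`**: `π(1−π)·w·(2D − w) ≤ π(1−π)·w·(2G − w) ≤ π(1−π)·G² ≤ G²/4`
(no lower bound on `D` is needed). -/
theorem noiseBudget_of_meanGapLE (F : Finset K) {q : K → K}
    (hq01 : ∀ η, 0 ≤ η → η ≤ 1 → 0 ≤ q η ∧ q η ≤ 1) {G : K} :
    ∀ (x : ℕ → K) (n : ℕ) (s : K), MeanGapLE F q G x n s → NoiseBudget F q G x n s := by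
  intro x n
  induction n generalizing x with
  | zero => intro s _; trivial
  | succ n ih =>
    rintro s ⟨hD, hu, hd⟩
    refine ⟨?_, ih _ _ hu, ih _ _ hd⟩
    have hγ0 : 0 ≤ up F (s + x 0) - dn F (s + x 0) := sub_nonneg.mpr (dn_le_up F _)
    obtain ⟨hp0, hp1⟩ := pUpQ_mem F hq01 (s + x 0)
    rw [nodeNoise_eq]
    set π := pUpQ F q (s + x 0)
    set w := up F (s + x 0) - dn F (s + x 0)
    set D := meanGap F q (fun i => x (i + 1)) n (s + x 0)
    clear_value π w D
    have h1 : π * (1 - π) ≤ 1 / 4 := by nlinarith [sq_nonneg (π - 1 / 2)]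
    have h2 : 0 ≤ π * (1 - π) := mul_nonneg hp0 (sub_nonneg.mpr hp1)
    have h3 : w * (2 * D - w) ≤ G ^ 2 := by nlinarith [hγ0, hD, sq_nonneg (G - w)]
    calc π * (1 - π) * w * (2 * D - w) = (π * (1 - π)) * (w * (2 * D - w)) := by ring
      _ ≤ (π * (1 - π)) * G ^ 2 := mul_le_mul_of_nonneg_left h3 h2
      _ ≤ (1 / 4) * G ^ 2 := mul_le_mul_of_nonneg_right h1 (sq_nonneg G)
      _ = G ^ 2 / 4 := by ring

/-- **`GapLE G ∧ DriftAntitone ⇒ MeanGapLE G`**: `D = w + Δ ≤ w ≤ G`. -/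
theorem meanGapLE_of_driftAntitone (F : Finset K) (q : K → K) {G : K} :
    ∀ (x : ℕ → K) (n : ℕ) (s : K), GapLE F G x n s → DriftAntitone F q x n s →
      MeanGapLE F q G x n s := by
  intro x n
  induction n generalizing x with
  | zero => intro s _ _; trivial
  | succ n ih =>
    rintro s ⟨hg0, hgu, hgd⟩ ⟨hΔ, hau, had⟩
    refine ⟨?_, ih _ _ hgu hau, ih _ _ hgd had⟩
    have hγ : up F (s + x 0) - dn F (s + x 0) ≤ G := hg0
    unfold meanGap; linarith [hΔ]

/-- **The Pythagorean law from the mean-gap criterion**: `NoSat ∧ GapLE G ∧ MeanGapLE G ⇒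
E(ŝₙ − sₙ)² ≤ n·G²/4 + (n·ε·G)²`, for every admissible rule `q`, any value set, any window, any
sign pattern. -/
theorem accExpQ_sq_le_of_meanGapLE (F : Finset K) {q : K → K} {ε G : K}
    (hq01 : ∀ η, 0 ≤ η → η ≤ 1 → 0 ≤ q η ∧ q η ≤ 1) (hq : ∀ η, 0 ≤ η → η ≤ 1 → |q η - η| ≤ ε)
    (x : ℕ → K) (n : ℕ) (s : K) (hns : NoSat F x n s) (hgap : GapLE F G x n s)
    (hm : MeanGapLE F q G x n s) :
    accExpQ F q x n (fun t => (t - (s + ∑ i ∈ range n, x i)) ^ 2) s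
      ≤ n * (G ^ 2 / 4) + (n * (ε * G)) ^ 2 :=
  accExpQ_sq_le_of_noiseBudget F hq01 hq x n s hns hgap (noiseBudget_of_meanGapLE F hq01 x n s hm)

section StochasticA
variable [FloorRing K]

/-- `StochasticA`, mean-gap form: `NoSat ∧ GapLE G ∧ MeanGapLE G ⇒
E(ŝₙ − sₙ)² ≤ n·G²/4 + (n·2^{-N}·G)²`. -/
theorem stochasticA_acc_sq_le_of_meanGapLE (F : Finset K) (N : ℕ) {G : K}
    (x : ℕ → K) (n : ℕ) (s : K) (hns : NoSat F x n s) (hgap : GapLE F G x n s)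
    (hm : MeanGapLE F (probAwayA N) G x n s) :
    accExpQ F (probAwayA N) x n (fun t => (t - (s + ∑ i ∈ range n, x i)) ^ 2) s
      ≤ n * (G ^ 2 / 4) + (n * (1 / 2 ^ N * G)) ^ 2 :=
  accExpQ_sq_le_of_meanGapLE F (probAwayA_mem N) (fun η _ _ => abs_probAwayA_sub_le N η) x n s
    hns hgap hm

/-- `StochasticA`, variance form: `NoSat ∧ GapLE G ∧ Var ŝₙ ≤ n·G²/4 ⇒
E(ŝₙ − sₙ)² ≤ n·G²/4 + (n·2^{-N}·G)²`. -/
theorem stochasticA_acc_sq_le_of_varQ_le (F : Finset K) (N : ℕ) {G : K}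
    (x : ℕ → K) (n : ℕ) (s : K) (hns : NoSat F x n s) (hgap : GapLE F G x n s)
    (hV : varQ F (probAwayA N) x n s ≤ n * (G ^ 2 / 4)) :
    accExpQ F (probAwayA N) x n (fun t => (t - (s + ∑ i ∈ range n, x i)) ^ 2) s
      ≤ n * (G ^ 2 / 4) + (n * (1 / 2 ^ N * G)) ^ 2 :=
  accExpQ_sq_le_of_varQ_le F (probAwayA_mem N) (fun η _ _ => abs_probAwayA_sub_le N η) x n s
    hns hgap hV

end StochasticA
end LimitedBits

namespace Formats
open LimitedBits

/-- **All six sharpness witnesses of the bits threshold satisfy the mean-gap criterion** (kernel;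
same trees and widths `G` as `threshold_witnesses_noiseBudget`; none is drift-antitone, CI). -/
theorem threshold_witnesses_meanGapLE :
    MeanGapLE e3m2 (probAwayA 0) 1 (seqL [5 / 4, 5 / 2]) 2 1 ∧
    MeanGapLE e3m2 (probAwayA 1) 1 (seqL [-9 / 8, 5 / 2]) 2 3 ∧
    MeanGapLE e3m2 (probAwayA 2) 2 (seqL [1 / 8, 67 / 8]) 2 1 ∧
    MeanGapLE e3m2 (probAwayA 3) 2 (seqL [1 / 16, 135 / 16]) 2 (1 / 2) ∧
    MeanGapLE e3m2 (probAwayA 4) 2 (seqL [1 / 32, 519 / 64]) 2 0 ∧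
    MeanGapLE FP4.e2m1 (probAwayA 1) 2 (seqL [1 / 8, 4]) 2 (1 / 2) := by
  refine ⟨?_, ?_, ?_, ?_, ?_, ?_⟩ <;> (rw [← meanGapLEB_iff]; decide +kernel)

/-- Witness summands `45/16, −31/8, 11/2` (three additions from `5/4`; exact sum `91/16`). -/
def xMG : ℕ → ℚ := seqL [45 / 16, -31 / 8, 11 / 2]

/-- **`NoiseBudget` does NOT imply `MeanGapLE`** (kernel).  E3M2, `StochasticA`, `N = 2`, from
`5/4` add `45/16, −31/8, 11/2`: one-signed window `[1/8, 7]` (`G = 1`), no saturation, gaps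
`≤ 1`; the root `c = 65/16` (cell `[4, 5]`, `π = 0`) has mean gap `9/8 > 1 = G`, yet every node
noise is `≤ 1/4` (`NoiseBudget 1`), so the law `E(ŝ₃ − 91/16)² ≤ 3/4 + 9/16` holds by CX (value
`73/256`; `Var ŝ₃ = 𝒩 = 1/4`). -/
theorem e3m2_noiseBudget_not_meanGapLE :
    InWindow e3m2 (1 / 8) 7 xMG 3 (5 / 4) ∧ NoSat e3m2 xMG 3 (5 / 4) ∧ GapLE e3m2 1 xMG 3 (5 / 4) ∧
    NoiseBudget e3m2 (probAwayA 2) 1 xMG 3 (5 / 4) ∧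
    ¬ MeanGapLE e3m2 (probAwayA 2) 1 xMG 3 (5 / 4) ∧
    meanGap e3m2 (probAwayA 2) (fun i => xMG (i + 1)) 2 (5 / 4 + xMG 0) = 9 / 8 ∧
    varQ e3m2 (probAwayA 2) xMG 3 (5 / 4) = 1 / 4 ∧
    noiseQ e3m2 (probAwayA 2) xMG 3 (5 / 4) = 1 / 4 ∧
    accExpQ e3m2 (probAwayA 2) xMG 3 (fun t => (t - 91 / 16) ^ 2) (5 / 4) = 73 / 256 := by
  refine ⟨?_, ?_, ?_, ?_, ?_, by decide +kernel, by decide +kernel, by decide +kernel,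
    by decide +kernel⟩
  · rw [← inWindowB_iff]; decide +kernel
  · rw [← noSatB_iff]; decide +kernel
  · rw [← gapLEB_iff]; decide +kernel
  · rw [← noiseBudgetB_iff]; decide +kernel
  · rw [← meanGapLEB_iff]; decide +kernel

/-- **CX's tree `xNB` (local noise budget violated) satisfies `VAR-LE`** (kernel): root mean gap
`17/8 > 2 = G` (`¬ MeanGapLE 2`), `Var ŝ₃ = 423/256 ≤ 3 = 3·G²/4`, so the law
`E(ŝ₃ − 153/16)² ≤ 3 + 9/4 = 21/4` also follows from `stochasticA_acc_sq_le_of_varQ_le`. -/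
theorem e3m2_xNB_varLE :
    ¬ MeanGapLE e3m2 (probAwayA 2) 2 xNB 3 2 ∧
    meanGap e3m2 (probAwayA 2) (fun i => xNB (i + 1)) 2 (2 + xNB 0) = 17 / 8 ∧
    varQ e3m2 (probAwayA 2) xNB 3 2 = 423 / 256 ∧
    varQ e3m2 (probAwayA 2) xNB 3 2 ≤ (3 : ℕ) * ((2 : ℚ) ^ 2 / 4) ∧
    accExpQ e3m2 (probAwayA 2) xNB 3 (fun t => (t - 153 / 16) ^ 2) 2 ≤ 21 / 4 := by
  have hns : NoSat e3m2 xNB 3 2 := e3m2_noiseBudget_fails_noiseQ_le.2.1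
  have hg : GapLE e3m2 2 xNB 3 2 := e3m2_noiseBudget_fails_noiseQ_le.2.2.1
  have hV : varQ e3m2 (probAwayA 2) xNB 3 2 ≤ (3 : ℕ) * ((2 : ℚ) ^ 2 / 4) := by decide +kernel
  have hS : (2 : ℚ) + ∑ i ∈ range 3, xNB i = 153 / 16 := by
    norm_num [xNB, seqL, Finset.sum_range_succ]
  have hlaw := stochasticA_acc_sq_le_of_varQ_le e3m2 2 xNB 3 2 hns hg hV
  rw [hS] at hlaw
  refine ⟨?_, by decide +kernel, by decide +kernel, hV, hlaw.trans (le_of_eq (by norm_num))⟩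
  rw [← meanGapLEB_iff]; decide +kernel

/-- **`VAR-LE` is attained** (E3M2, two bits): from `1` add `175/128, 27/32, 37/128` — three fair
coins in the equally spaced window `[2, 4]` (`G = 1/2`): `Var ŝ₃ = 3/16 = 3·G²/4 = 𝒩`
(`e3m2_noiseQ_attains`). -/
theorem e3m2_varQ_attains :
    varQ e3m2 (probAwayA 2) (seqL [175 / 128, 27 / 32, 37 / 128]) 3 1
      = (3 : ℕ) * (((1 : ℚ) / 2) ^ 2 / 4) := by
  decide +kernel

/-- Witness summands `−45/16, 691/64, −45/4, 25/2` (four additions from `5`). -/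
def xINC : ℕ → ℚ := seqL [-45 / 16, 691 / 64, -45 / 4, 25 / 2]

/-- **One more step can add more than `G²/4` to `𝒩`** (kernel; so `NOISE-LE` admits no induction
on the number of steps with budget `G²/4` per step).  E3M2, `StochasticA`, `N = 2`, from `5` add
`−45/16, 691/64, −45/4, 25/2`: one-signed window `[3/4, 16]` (`G = 2`) for the four-step tree and
its three-step prefix; `𝒩(3 steps) = 225/256`, `𝒩(4 steps) = 263/128`, increment
`301/256 > 1 = G²/4` (both trees satisfy `NOISE-LE`: `225/256 ≤ 3`, `263/128 ≤ 4`). -/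
theorem e3m2_noise_increment_exceeds :
    InWindow e3m2 (3 / 4) 16 xINC 4 5 ∧
    noiseQ e3m2 (probAwayA 2) xINC 3 5 = 225 / 256 ∧
    noiseQ e3m2 (probAwayA 2) xINC 4 5 = 263 / 128 ∧
    noiseQ e3m2 (probAwayA 2) xINC 4 5 - noiseQ e3m2 (probAwayA 2) xINC 3 5 > (2 : ℚ) ^ 2 / 4 := by
  refine ⟨?_, by decide +kernel, by decide +kernel, by decide +kernel⟩
  rw [← inWindowB_iff]; decide +kernel

end Formats

end Summit.Ventures.CertifiedArithmetic.LowPrec.SR
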